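import Summits.CriticalPhenomena.PercolationContinuityZ3.Theorems.Transplant.FKConnectivityAllQEdgeNegCorr
import HarnessLib

/-!
# Connectivity correlation inequalities for `φ_{w,q}`, every `q > 0` — file 7: the SUPPORT-RESTRICTED form of
# "edge-negative association ⇒ pairwise positive correlation of connection events" (for classes of graphs)

Support file (`--supports stmt-CriticalPhenomena-4575`), FK sub-lane `prim-bschramm-fk-2` (gen 6) of the post-continuity
programme; builds on p205010 (kernel theorem, internal audit signed; external expert review pending).  No definitions, no named
facts, no sorries; standard axioms.

The global theorems of `…AllQEdgeMono.lean` / `…AllQEdgeNegCorr.lean` (`EdgeNegCorrOn V q → PairConnPosUnder …` for `0 < q < 1`)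
quantify their hypothesis over ALL weight vectors on `V`.  Their proofs, however, only ever visit weight vectors obtained from the given
one by PINNING pairs to `0` or `1` and by inserting the two target pairs `xy`, `uv` (at parameter `½`): all of these are supported
inside `supp(w) ∪ {xy, uv}`.  This file records that bookkeeping, so that edge-negative association ON A CLASS OF SUPPORTS closed
under deletion — e.g. Wagner's theorem that series–parallel graphs are Potts–Rayleigh for every `0 < q ≤ 1` (Wagner 2008,
Ex. 5.1 + Thm. 5.8: negative edge correlation for `φ_{G,𝐩,q}`, all `𝐩`, whenever `G` has no `K₄` minor; not in the tree) — yields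
pairwise positive correlation of connection events for pairs inside that support:
* `FK.edgeConnMono_of_negCorr_at` (`0 < q < 1`): ONE instance of edge-negative association, at `w[xy ↦ c][f ↦ c]` for any interior
  `c`, gives the EC⁺ instance `φ_{w[f↦0]}(x↔y) ≤ φ_{w[f↦1]}(x↔y)`.
* `FK.pairConn_mass_le_of_edgeConnMono_on`: the Bernstein induction of `…AllQEdgeMono.lean` run inside a set `S` of allowed pairs
  (EC⁺ assumed only for weight vectors supported in `S`, only at fractional pairs, only for the two target events).
* **`FK.pairConnPosUnder_of_edgeNegCorr_on`** (`0 < q < 1`): if `φ_u(J_e ∩ J_f) ≤ φ_u(J_e)φ_u(J_f)` for every weight vector `u`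
  supported in `S` and all pairs `e ≠ f` (`e` not a loop), then `φ_w(x↔y)φ_w(u↔v) ≤ φ_w(x↔y, u↔v)` for every `w` supported in `S`
  whenever `s(x,y), s(u,v) ∈ S`.  With `S` = the edge set of a series–parallel graph this is, on paper, the hub inequality
  `φ(o↔a)φ(a↔b) ≤ φ(o↔a↔b)` (Ayyer–Linusson–Ravichandran 2025 (13)) along every edge-path `o–a–b` of every series–parallel
  weighted graph at every `q ∈ (0,1)`, by Wagner's theorem.
[cite: Grimmett2006, §3.9 eq. (3.94) (pp. 63–64); Thm. (3.1)(a) (p. 37)] [cite: AyyerLinussonRavichandran2025, §7 eq. (13)–(15) (p. 22)]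
[cite: Wagner2006, Ex. 5.1, Thm. 5.8, §5.3]
-/

noncomputable section

namespace Summit.CriticalPhenomena.PercolationContinuityZ3.Theorems

namespace FK

open MeasureTheory Set Literature.Probability.LatticeModels Literature.Probability.Percolation
open Literature.Probability.Percolation.DecisionTree (ind ind_of_mem ind_of_not_mem ind_nonneg)
open Literature.Probability.Percolation.TwoAvoidanceSets (ind_mul_ind)
open scoped Classical symmDiff

variable {V : Type*} [Fintype V]

/-! ### One instance of negative edge correlation gives one instance of EC⁺ -/

/-- **Local form of `NC ⇒ EC⁺`** (`0 < q < 1`): edge-negative association of the pairs `e = s(x,y)` and `f` in the single state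
`w[e ↦ c][f ↦ c]` (`0 < c < 1`) implies `φ_{w[f↦0]}(x ↔ y) ≤ φ_{w[f↦1]}(x ↔ y)`. [cite: Grimmett2006, §3.9 eq. (3.94) (p. 63); Thm. (3.1)(a) (p. 37)] -/
theorem edgeConnMono_of_negCorr_at {q : ℝ} (hq0 : 0 < q) (hq1 : q < 1) (w : Sym2 V → unitInterval) (f : Sym2 V) (x y : V)
    (c : unitInterval) (hc0 : 0 < (c : ℝ)) (hc1 : (c : ℝ) < 1)
    (hN : x ≠ y → f ≠ s(x, y) →
      (rcMeasureW (Function.update (Function.update w s(x, y) c) f c) q ∅).real ({ω | s(x, y) ∈ ω} ∩ {ω | f ∈ ω}) ≤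
        (rcMeasureW (Function.update (Function.update w s(x, y) c) f c) q ∅).real {ω | s(x, y) ∈ ω} *
          (rcMeasureW (Function.update (Function.update w s(x, y) c) f c) q ∅).real {ω | f ∈ ω}) :
    (rcMeasureW (Function.update w f 0) q ∅).real (openConn x y) ≤
      (rcMeasureW (Function.update w f 1) q ∅).real (openConn x y) := by
  -- trivial case `x = y`
  by_cases hxy : x = y
  · rw [← hxy]
    have huniv : (openConn x x : Set (BondConfig V)) = Set.univ :=
      Set.eq_univ_of_forall fun ω => (mem_openConn_iff' x x ω).2 (SimpleGraph.Reachable.refl x)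
    haveI := isProbabilityMeasure_rcMeasureW (Function.update w f 0) hq0 (∅ : Set V)
    haveI := isProbabilityMeasure_rcMeasureW (Function.update w f 1) hq0 (∅ : Set V)
    rw [huniv, probReal_univ, probReal_univ]
  rw [edgeConnMono_iff_compl_mass hq0]
  -- trivial case `f = e`
  by_cases hfe : f = s(x, y)
  · rw [hfe, sum_rcWeightW_update_one_compl_openConn w q x y, zero_mul]
    exact mul_nonneg (Finset.sum_nonneg fun ω _ => mul_nonneg (rcWeightW_nonneg _ hq0.le ∅ ω) (ind_nonneg _ ω))
      (rcPartitionFunctionW_pos _ hq0 ∅).le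
  refine compl_openConn_mono_lift w hq0 x y hfe ?_
  have hN' := hN hxy hfe
  have hZ := rcPartitionFunctionW_pos (Function.update (Function.update w s(x, y) c) f c) hq0 (∅ : Set V)
  rw [rcMeasureW_real_eq_sum_div _ hq0 ∅, rcMeasureW_real_eq_sum_div _ hq0 ∅, rcMeasureW_real_eq_sum_div _ hq0 ∅,
    div_mul_div_comm, div_le_div_iff₀ hZ (mul_pos hZ hZ)] at hN'
  have hdef : (∑ ω : BondConfig V, rcWeightW (Function.update (Function.update w s(x, y) c) f c) q ∅ ω *
          ind ({ω | s(x, y) ∈ ω} ∩ {ω | f ∈ ω}) ω) * rcPartitionFunctionW (Function.update (Function.update w s(x, y) c) f c) q ∅ -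
      (∑ ω : BondConfig V, rcWeightW (Function.update (Function.update w s(x, y) c) f c) q ∅ ω * ind {ω | s(x, y) ∈ ω} ω) *
        (∑ ω : BondConfig V, rcWeightW (Function.update (Function.update w s(x, y) c) f c) q ∅ ω * ind {ω | f ∈ ω} ω) ≤ 0 := by
    have h' : ((∑ ω : BondConfig V, rcWeightW (Function.update (Function.update w s(x, y) c) f c) q ∅ ω *
            ind ({ω | s(x, y) ∈ ω} ∩ {ω | f ∈ ω}) ω) * rcPartitionFunctionW (Function.update (Function.update w s(x, y) c) f c) q ∅ -
        (∑ ω : BondConfig V, rcWeightW (Function.update (Function.update w s(x, y) c) f c) q ∅ ω * ind {ω | s(x, y) ∈ ω} ω) *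
          (∑ ω : BondConfig V, rcWeightW (Function.update (Function.update w s(x, y) c) f c) q ∅ ω * ind {ω | f ∈ ω} ω)) *
          rcPartitionFunctionW (Function.update (Function.update w s(x, y) c) f c) q ∅ ≤
        0 * rcPartitionFunctionW (Function.update (Function.update w s(x, y) c) f c) q ∅ := by nlinarith [hN']
    exact le_of_mul_le_mul_right h' hZ
  rw [negCorr_defect_eq _ hq0.ne' x y hfe] at hdef
  have hue : Function.update (Function.update w s(x, y) c) f c s(x, y) = c := by
    rw [Function.update_of_ne (Ne.symm hfe), Function.update_self]
  have huf : Function.update (Function.update w s(x, y) c) f c f = c := by rw [Function.update_self]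
  have hcorner : ∀ b : unitInterval, Function.update (Function.update (Function.update (Function.update w s(x, y) c) f c) s(x, y) 0) f b =
      Function.update (Function.update w s(x, y) 0) f b := by
    intro b
    rw [Function.update_comm hfe, Function.update_idem, Function.update_idem]
  rw [hue, huf, hcorner 0, hcorner 1] at hdef
  have hpos : 0 < (c : ℝ) * (1 - (c : ℝ)) * ((c : ℝ) * (1 - (c : ℝ))) * (q⁻¹ - 1) := by
    have hr : 0 < q⁻¹ - 1 := by rw [sub_pos]; exact (one_lt_inv_iff₀.2 ⟨hq0, hq1⟩)
    have h1c : 0 < 1 - (c : ℝ) := by linarith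
    positivity
  by_contra hcon
  have hb : 0 < (∑ ω : BondConfig V, rcWeightW (Function.update (Function.update w s(x, y) 0) f 1) q ∅ ω *
        ind (openConn x y : Set (BondConfig V))ᶜ ω) *
      rcPartitionFunctionW (Function.update (Function.update w s(x, y) 0) f 0) q ∅ -
      (∑ ω : BondConfig V, rcWeightW (Function.update (Function.update w s(x, y) 0) f 0) q ∅ ω *
        ind (openConn x y : Set (BondConfig V))ᶜ ω) *
      rcPartitionFunctionW (Function.update (Function.update w s(x, y) 0) f 1) q ∅ := by linarith [not_le.1 hcon]
  linarith [mul_pos hpos hb]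

/-! ### The Bernstein induction inside a set of allowed pairs -/

/-- **Support-restricted mass inequality**: if EC⁺ holds for the two target events `{x↔y}`, `{u↔v}` at every FRACTIONAL pair of every
weight vector supported in `S`, then `S_w(x↔y)·S_w(u↔v) ≤ Z_w·S_w(x↔y, u↔v)` for every `w` supported in `S` (the induction of
`pairConn_mass_le_of_edgeConnMonoOn` never leaves `S`). [cite: AyyerLinussonRavichandran2025, §7 eq. (13)–(15) (p. 22)] -/
theorem pairConn_mass_le_of_edgeConnMono_on {q : ℝ} (hq : 0 < q) (S : Set (Sym2 V)) (x y u v : V)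
    (hA : ∀ w' : Sym2 V → unitInterval, (∀ e, ((w' e : unitInterval) : ℝ) ≠ 0 → e ∈ S) → ∀ e : Sym2 V,
      0 < ((w' e : unitInterval) : ℝ) → ((w' e : unitInterval) : ℝ) < 1 →
        (rcMeasureW (Function.update w' e 0) q ∅).real (openConn x y) ≤ (rcMeasureW (Function.update w' e 1) q ∅).real (openConn x y))
    (hB : ∀ w' : Sym2 V → unitInterval, (∀ e, ((w' e : unitInterval) : ℝ) ≠ 0 → e ∈ S) → ∀ e : Sym2 V,
      0 < ((w' e : unitInterval) : ℝ) → ((w' e : unitInterval) : ℝ) < 1 →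
        (rcMeasureW (Function.update w' e 0) q ∅).real (openConn u v) ≤ (rcMeasureW (Function.update w' e 1) q ∅).real (openConn u v))
    (w : Sym2 V → unitInterval) (hw : ∀ e, ((w e : unitInterval) : ℝ) ≠ 0 → e ∈ S) :
    (∑ ω : BondConfig V, rcWeightW w q ∅ ω * ind (openConn x y) ω) *
        (∑ ω : BondConfig V, rcWeightW w q ∅ ω * ind (openConn u v) ω) ≤
      rcPartitionFunctionW w q ∅ *
        ∑ ω : BondConfig V, rcWeightW w q ∅ ω * ind (openConn x y ∩ openConn u v) ω := by
  set cF : (Sym2 V → unitInterval) → ℕ := fun w =>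
    (Finset.univ.filter (fun p : Sym2 V => 0 < ((w p : unitInterval) : ℝ) ∧ ((w p : unitInterval) : ℝ) < 1)).card
    with hcF
  have main : ∀ (N : ℕ) (w : Sym2 V → unitInterval), cF w = N → (∀ e, ((w e : unitInterval) : ℝ) ≠ 0 → e ∈ S) →
      (∑ ω : BondConfig V, rcWeightW w q ∅ ω * ind (openConn x y) ω) *
          (∑ ω : BondConfig V, rcWeightW w q ∅ ω * ind (openConn u v) ω) ≤
        rcPartitionFunctionW w q ∅ *
          ∑ ω : BondConfig V, rcWeightW w q ∅ ω * ind (openConn x y ∩ openConn u v) ω := by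
    intro N
    induction N using Nat.strong_induction_on with
    | _ N ih =>
    intro w hN hw
    have hdec : ∀ (p₀ : Sym2 V) (c : unitInterval), ((c : ℝ) = 0 ∨ (c : ℝ) = 1) →
        (0 < ((w p₀ : unitInterval) : ℝ) ∧ ((w p₀ : unitInterval) : ℝ) < 1) → cF (Function.update w p₀ c) < N := by
      intro p₀ c hc hp₀
      rw [← hN]
      simp only [hcF]
      apply Finset.card_lt_card
      rw [Finset.ssubset_iff_of_subset]
      · refine ⟨p₀, Finset.mem_filter.2 ⟨Finset.mem_univ _, hp₀⟩, fun h => ?_⟩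
        have h' := (Finset.mem_filter.1 h).2
        simp only [Function.update_self] at h'
        rcases hc with hc | hc
        · linarith [h'.1]
        · linarith [h'.2]
      · intro p hp
        have h' := (Finset.mem_filter.1 hp).2
        by_cases hpp : p = p₀
        · subst hpp
          simp only [Function.update_self] at h'
          rcases hc with hc | hc
          · linarith [h'.1]
          · linarith [h'.2]
        · rw [Function.update_of_ne hpp] at h'
          exact Finset.mem_filter.2 ⟨Finset.mem_univ _, h'⟩
    -- pinning a pair keeps the support inside `S`
    have hsupp : ∀ (p₀ : Sym2 V) (c : unitInterval), ((w p₀ : unitInterval) : ℝ) ≠ 0 →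
        ∀ e, ((Function.update w p₀ c e : unitInterval) : ℝ) ≠ 0 → e ∈ S := by
      intro p₀ c hp₀ e he
      by_cases hep : e = p₀
      · subst hep; exact hw e hp₀
      · rw [Function.update_of_ne hep] at he; exact hw e he
    by_cases hF0 : (Finset.univ.filter (fun p : Sym2 V =>
        0 < ((w p : unitInterval) : ℝ) ∧ ((w p : unitInterval) : ℝ) < 1)) = ∅
    · have hR : ∀ p : Sym2 V, ((w p : unitInterval) : ℝ) = 0 ∨ ((w p : unitInterval) : ℝ) = 1 := by
        intro p
        by_contra hcon
        have hne0 : ((w p : unitInterval) : ℝ) ≠ 0 := fun h => hcon (Or.inl h)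
        have hne1 : ((w p : unitInterval) : ℝ) ≠ 1 := fun h => hcon (Or.inr h)
        have hw0 : 0 ≤ ((w p : unitInterval) : ℝ) := (w p).2.1
        have hw1 : ((w p : unitInterval) : ℝ) ≤ 1 := (w p).2.2
        have : p ∈ Finset.univ.filter (fun p : Sym2 V =>
            0 < ((w p : unitInterval) : ℝ) ∧ ((w p : unitInterval) : ℝ) < 1) :=
          Finset.mem_filter.2 ⟨Finset.mem_univ _, lt_of_le_of_ne hw0 hne0.symm, lt_of_le_of_ne hw1 hne1⟩
        rw [hF0] at this
        exact absurd this (Finset.notMem_empty _)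
      rw [sum_rcWeightW_ind_rigid w q hR (openConn x y), sum_rcWeightW_ind_rigid w q hR (openConn u v),
        sum_rcWeightW_ind_rigid w q hR (openConn x y ∩ openConn u v)]
      have hZ : rcPartitionFunctionW w q ∅ = rcWeightW w q ∅ {e | ((w e : unitInterval) : ℝ) = 1} := by
        have h := sum_rcWeightW_ind_rigid w q hR Set.univ
        simp only [ind_of_mem (Set.mem_univ _), mul_one] at h
        exact h
      rw [hZ, ← ind_mul_ind (openConn x y) (openConn u v)]
      exact le_of_eq (by ring)
    · obtain ⟨e, heF⟩ := Finset.nonempty_iff_ne_empty.2 hF0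
      obtain ⟨he0, he1⟩ := (Finset.mem_filter.1 heF).2
      rw [sum_rcWeightW_ind_affine w q e (openConn x y ∩ openConn u v), sum_rcWeightW_ind_affine w q e (openConn x y),
        sum_rcWeightW_ind_affine w q e (openConn u v), rcPartitionFunctionW_affine w q e]
      exact pair_bernstein_step _ _ _ _ _ _ _ _ _ he0.le he1.le
        (ih _ (hdec e 0 (Or.inl rfl) ⟨he0, he1⟩) (Function.update w e 0) rfl (hsupp e 0 he0.ne'))
        (ih _ (hdec e 1 (Or.inr rfl) ⟨he0, he1⟩) (Function.update w e 1) rfl (hsupp e 1 he0.ne'))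
        ((real_le_real_iff_mass hq _ _).1 (hA w hw e he0 he1)) ((real_le_real_iff_mass hq _ _).1 (hB w hw e he0 he1))
        (rcPartitionFunctionW_pos (Function.update w e 0) hq ∅) (rcPartitionFunctionW_pos (Function.update w e 1) hq ∅)
  exact main _ w rfl hw

/-! ### Edge-negative association on a support ⇒ positive correlation of connections inside it -/

/-- **Edge-negative association for weight vectors supported in `S` ⇒ pairwise positive correlation of the connection events of two
pairs in `S`** (`0 < q < 1`).  With `S` a `K₄`-minor-free edge set the hypothesis is Wagner's theorem (series–parallel graphs are
Potts–Rayleigh for all `0 < q ≤ 1`), giving e.g. the hub inequality along every edge-path `o–a–b` of a series–parallel graph.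
[cite: Wagner2006, Ex. 5.1, Thm. 5.8, §5.3] [cite: AyyerLinussonRavichandran2025, §7 eq. (13) (p. 22)] [cite: Grimmett2006, §3.9 (pp. 63–64)] -/
theorem pairConnPosUnder_of_edgeNegCorr_on {q : ℝ} (hq0 : 0 < q) (hq1 : q < 1) (S : Set (Sym2 V))
    (hNC : ∀ u' : Sym2 V → unitInterval, (∀ e, ((u' e : unitInterval) : ℝ) ≠ 0 → e ∈ S) → ∀ e f : Sym2 V, ¬ e.IsDiag → f ≠ e →
      (rcMeasureW u' q ∅).real ({ω | e ∈ ω} ∩ {ω | f ∈ ω}) ≤ (rcMeasureW u' q ∅).real {ω | e ∈ ω} * (rcMeasureW u' q ∅).real {ω | f ∈ ω})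
    (x y u v : V) (hxy : s(x, y) ∈ S) (huv : s(u, v) ∈ S) (w : Sym2 V → unitInterval)
    (hw : ∀ e, ((w e : unitInterval) : ℝ) ≠ 0 → e ∈ S) : PairConnPosUnder (rcMeasureW w q ∅) x y u v := by
  -- EC⁺ for a target event at every fractional pair of every weight vector supported in `S`
  have hEC : ∀ (a b : V), s(a, b) ∈ S → ∀ w' : Sym2 V → unitInterval, (∀ e, ((w' e : unitInterval) : ℝ) ≠ 0 → e ∈ S) →
      ∀ e : Sym2 V, 0 < ((w' e : unitInterval) : ℝ) → ((w' e : unitInterval) : ℝ) < 1 →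
        (rcMeasureW (Function.update w' e 0) q ∅).real (openConn a b) ≤
          (rcMeasureW (Function.update w' e 1) q ∅).real (openConn a b) := by
    intro a b hab w' hw' f hf0 _
    set half : unitInterval := ⟨2⁻¹, by norm_num, by norm_num⟩ with hhalf
    refine edgeConnMono_of_negCorr_at hq0 hq1 w' f a b half (by norm_num [hhalf]) (by norm_num [hhalf]) fun hab' hfe => ?_
    refine hNC _ (fun e he => ?_) s(a, b) f (by rw [Sym2.mk_isDiag_iff]; exact hab') hfe
    -- the support of `w'[ab ↦ ½][f ↦ ½]` lies in `S`
    by_cases hef : e = f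
    · subst hef; exact hw' e hf0.ne'
    · rw [Function.update_of_ne hef] at he
      by_cases heab : e = s(a, b)
      · subst heab; exact hab
      · rw [Function.update_of_ne heab] at he; exact hw' e he
  have hmass := pairConn_mass_le_of_edgeConnMono_on hq0 S x y u v (hEC x y hxy) (hEC u v huv) w hw
  haveI := isProbabilityMeasure_rcMeasureW w hq0 (∅ : Set V)
  unfold PairConnPosUnder
  rw [probReal_univ, one_mul, rcMeasureW_real_eq_sum_div w hq0 ∅ (openConn x y), rcMeasureW_real_eq_sum_div w hq0 ∅ (openConn u v),
    rcMeasureW_real_eq_sum_div w hq0 ∅ (openConn x y ∩ openConn u v)]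
  have hZ := rcPartitionFunctionW_pos w hq0 (∅ : Set V)
  rw [div_mul_div_comm, div_le_div_iff₀ (mul_pos hZ hZ) hZ]
  calc (∑ ω : BondConfig V, rcWeightW w q ∅ ω * ind (openConn x y) ω) *
          (∑ ω : BondConfig V, rcWeightW w q ∅ ω * ind (openConn u v) ω) * rcPartitionFunctionW w q ∅
      ≤ (rcPartitionFunctionW w q ∅ * ∑ ω : BondConfig V, rcWeightW w q ∅ ω * ind (openConn x y ∩ openConn u v) ω) *
          rcPartitionFunctionW w q ∅ := mul_le_mul_of_nonneg_right hmass hZ.le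
    _ = (∑ ω : BondConfig V, rcWeightW w q ∅ ω * ind (openConn x y ∩ openConn u v) ω) *
          (rcPartitionFunctionW w q ∅ * rcPartitionFunctionW w q ∅) := by ring

/-- **Hub inequality along allowed pairs**: under edge-negative association on `S`, `φ(o ↔ a)φ(b ↔ a) ≤ φ(o ↔ a ↔ b)` whenever
`s(o,a), s(b,a) ∈ S` and `w` is supported in `S` (`0 < q < 1`). [cite: AyyerLinussonRavichandran2025, §7 eq. (13) (p. 22)] [cite: Wagner2006, §5.3] -/
theorem hubUnder_of_edgeNegCorr_on {q : ℝ} (hq0 : 0 < q) (hq1 : q < 1) (S : Set (Sym2 V))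
    (hNC : ∀ u' : Sym2 V → unitInterval, (∀ e, ((u' e : unitInterval) : ℝ) ≠ 0 → e ∈ S) → ∀ e f : Sym2 V, ¬ e.IsDiag → f ≠ e →
      (rcMeasureW u' q ∅).real ({ω | e ∈ ω} ∩ {ω | f ∈ ω}) ≤ (rcMeasureW u' q ∅).real {ω | e ∈ ω} * (rcMeasureW u' q ∅).real {ω | f ∈ ω})
    (o a b : V) (hoa : s(o, a) ∈ S) (hba : s(b, a) ∈ S) (w : Sym2 V → unitInterval)
    (hw : ∀ e, ((w e : unitInterval) : ℝ) ≠ 0 → e ∈ S) : HubUnder (rcMeasureW w q ∅) o a b :=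
  hubUnder_of_pairConnPosUnder _ o a b (pairConnPosUnder_of_edgeNegCorr_on hq0 hq1 S hNC o a b a hoa hba w hw)

end FK

end Summit.CriticalPhenomena.PercolationContinuityZ3.Theorems

end
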